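import Literature.NumberTheory.GelbartRogawski1991.LocalParabolicScalarGaloisFixed
import Literature.NumberTheory.GelbartRogawski1991.LocalSplittingCMScaleTransport
import Literature.NumberTheory.GelbartRogawski1991.LocalKudlaSplittingRigiditySplit
import Literature.NumberTheory.GelbartRogawski1991.LocalScaleModelTransportUndoubling
import Literature.NumberTheory.GelbartRogawski1991.LocalDoubledUnitaryDeltaTransport
import Literature.NumberTheory.GelbartRogawski1991.DoubledUnitaryGlobalSplittingDataGen
import HarnessLib

/-!
# Rigidity of the `μ`-normalised doubled splitting under a Galois transport: the transport of the CM splitting of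
# `T₀` IS the CM splitting of `t•T₀`

Topic `NumberTheory/GelbartRogawski1991`; namespace `Literature.NumberTheory.GelbartRogawski1991.UnitaryDualPair.LocalSplitting`.
KERNEL ONLY: theorems; no definition, no named fact, no `sorry`.

Cell `hodgecm-mathlib`, row III-11 road (ε-rigidity under Galois twist, [Liu2021] App. C / proof of Thm. 4.18 (3)),
piece **P3b MAIN** (A-p19 seam rulings R3: «show that `galTwist σ ∘ (chiLocalSplittingsD … μ … a).s v`, transported to
`LocalMp … (t•T) v`, IS `(chiLocalSplittingsD … μ … (t·a)).s v` — NOT merely up to a character»), at the DOUBLED level and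
in a form AGNOSTIC of the two transports it is fed with:

* the Galois twist `σ ∘ M ∘ σ⁻¹` of the local metaplectic group of pairs (`HeisenbergGroup/SchrodingerGaloisTwist`,
  `GelbartRogawski1991/LocalMpGaloisTwist`: over the identity of `Sp(𝕎_v)`, `ω(galTwist p)(σ∘f) = σ∘(ω(p) f)`), and
* the dilation `D_s` identifying the `ψ_v(t s²·)`-Schrödinger model of `T` with the `ψ_v`-model of `t•T`
  (`HeisenbergGroup/SchrodingerAddCharDilation`, `GelbartRogawski1991/LocalMpAddCharRescaling`: over the identity on
  linear maps of `𝕎_v`, `ω(e p)(D_s f) = D_s(ω(p) f)`, `(D_s f)(0) = f(0)`),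

composed to ONE monoid homomorphism `Ψ : S̃p_ψ(𝕎^𝔻_v, T₀^𝔻) →* S̃p_ψ(𝕎^𝔻_v, (t•T₀)^𝔻)`.  All this file asks of `Ψ` is:
(Ψ1) it lies over the identity on linear maps of `𝕎^𝔻_v` (`hΨproj`); (Ψ2) there is a surjection `B` of `𝒮(F_v^{n+n})`
reading values at the origin through `σ` (`(B f)(0) = σ(f(0))`, `hB0`) with `(ω′(Ψ x)(B f))(0) = σ((ω(x) f)(0))` (`hΨB`)
— `B = D_s ∘ (σ ∘ ·)`; (Ψ3) the transported CM section lies over `ι^𝔻 ∘ scaleInl` (`hSproj`).  CONCLUSION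
(`comp_localSplittingDatumCM_eq_of_galoisTransport`):

  `Ψ ∘ s^𝔻_{T₀, μ} = s^𝔻_{t•T₀, μ} ∘ scaleInl`   (equality of homomorphisms `H(F_v) →* S̃p_ψ(𝕎^𝔻_v, (t•T₀)^𝔻)`).

PROOF = Kudla's rigidity (`eq_of_parabolic_toRep_conj_eq`, [Kudla1994, Thm. 3.1]; [GelbartRogawski1991] §3.1 Remark p. 457):
both sides lie over `ι^𝔻`, and both satisfy the `P_Δ`-normalisation with the SAME scalar
`c_v(p) = ∏_w χ_w(det_Δ p_w) ∏_w ‖det_Δ p_w‖^{1/2}`: the right side by `localSplittingDatumCM_parabolic`; the left side because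
conjugating by the mover `Ψ m₀` is `Ψ` of conjugating by `m₀`, values at the origin pass through `σ` by (Ψ2), and
**`σ(c_v(p)) = c_v(p)`** for `σ ∈ Aut(ℂ/M_μ)` (`ringEquiv_parabolicScalar_eq`, `LocalParabolicScalarGaloisFixed` — Liu's
«Since `Gal(ℂ/M_μ)` stabilizes `μ`», l. 2272), `det_Δ ∘ scaleInl = det_Δ`; every character of `H(F_v)` trivial on `P_Δ` is
trivial (`eq_one_of_forall_isSiegelDelta_eq_one'`, diagonal `T₀`, all places).

Also: `exists_mover_deltaLagrangian` — a lift to `S̃p_ψ` of the rational `δ` carrying `ℓ_Δ` onto `ℓ_Y` (any `T₀` with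
`det T₀ ≠ 0`), the mover every parabolic normalisation is read through.

## References
* [Liu2021] Y. Liu, Camb. J. Math. 9 (2021), proof of Thm. 4.18 (3), l. 2272; App. D Lem. D.1.
* [Kudla1994] S. Kudla, Israel J. Math. 87 (1994), §3 Thm. 3.1.  [GelbartRogawski1991] §3.1 Prop. 3.1.1, Remark p. 457.
* [HarrisKudlaSweet1996] §1 (1.11)–(1.16).  [MoeglinVignerasWaldspurger1987] Chap. 2 II.1.
-/

set_option autoImplicit false

noncomputable section

open NumberField IsDedekindDomain Matrix
open Literature.RepresentationTheory.HeisenbergGroup Literature.RepresentationTheory.HeisenbergGroup.SymplecticMatrix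
open Literature.NumberTheory.Automorphic Literature.NumberTheory.Automorphic.UnitaryGroup Literature.NumberTheory.Weil1964
open Literature.RepresentationTheory.HarrisKudlaSweet1996
open Literature.NumberTheory.GaloisRepresentations
open Literature.NumberTheory.Automorphic.IdeleClassGroup (toHeckeCharacter)

namespace Literature.NumberTheory.GelbartRogawski1991.UnitaryDualPair.LocalSplitting

/-! ## §1 A mover of `ℓ_Δ` onto `ℓ_Y` in `S̃p_ψ(𝕎^𝔻_v)` -/

section Mover

variable (F : Type) [Field F] [NumberField F] (v : HeightOneSpectrum (𝓞 F)) (n : ℕ) {T₀ : Matrix (Fin n) (Fin n) F}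

/-- **A mover of `ℓ_Δ` onto `ℓ_Y` exists in `S̃p_ψ(𝕎^𝔻_v)`**: the rational symplectic `δ` (`deltaD`, [GelbartRogawski1991]
§3.1 Prop. 3.1.1) read at `v` through the Darboux frame of `T₀^𝔻 ⊗ F_v` carries `ℓ_Δ` onto `ℓ_Y`
(`map_transportSp_deltaDiag_deltaLagrangian`), and every element of `Sp(𝕎_v)` lifts (`MpPsi.proj_surjective`).
[cite: GelbartRogawski1991, §3.1 Prop. 3.1.1 p. 455 L1–2] [cite: Kudla1994, §3] -/
theorem exists_mover_deltaLagrangian (hT₀d : IsUnit T₀.det) :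
    ∃ m₀ : LocalMp F (n + n) (gramD F n T₀) v,
      (deltaLagrangian F v n).map (toLin F v (MpPsi.proj _ m₀)) = lagrangianY F (n + n) v := by
  have hTv : IsUnit (localGram F (n + n) (gramD F n T₀) v).det :=
    UnitaryGroup.isUnit_det_map (algebraMap F (v.adicCompletion F)) (isUnit_det_gramD F n hT₀d)
  have hδ₀ := map_transportSp_deltaDiag_deltaLagrangian F v n hT₀d hTv
    (SymplecticMatrix.mapHom (algebraMap F (v.adicCompletion F)) (GRConstructionGen.deltaD F (n := n))) (by
      rw [SymplecticMatrix.coe_mapHom]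
      change (Matrix.reindex _ _ (deltaDiagMatrix F (Fin n))).map _ = _
      rw [Matrix.reindex_apply, Matrix.reindex_apply, ← Matrix.submatrix_map, deltaDiagMatrix_map])
  obtain ⟨m₀, hm₀'⟩ := MpPsi.proj_surjective _
    (existsImplementer_localSchrodinger F (n + n) (gramD F n T₀) (isUnit_det_gramD F n hT₀d) v)
    (transportSp (localGram F (n + n) (gramD F n T₀) v) hTv
      (SymplecticMatrix.mapHom (algebraMap F (v.adicCompletion F)) (GRConstructionGen.deltaD F (n := n))))
  exact ⟨m₀, by rw [hm₀']; exact hδ₀⟩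

end Mover

/-! ## §2 The Galois transport of the CM splitting of `T₀` is the CM splitting of `t • T₀` -/

section CM

variable (L : Type) [Field L] [NumberField L] [IsCMField L] (v : HeightOneSpectrum (𝓞 (maximalRealSubfield L)))
  [MeasurableSpace (v.adicCompletion (maximalRealSubfield L))] [BorelSpace (v.adicCompletion (maximalRealSubfield L))]
  (μ : MeasureTheory.Measure (v.adicCompletion (maximalRealSubfield L))) [μ.IsAddHaarMeasure]
  (n : ℕ) {T₀ T₀' : Matrix (Fin n) (Fin n) (maximalRealSubfield L)} {JD JD' : Matrix (Fin (n + n)) (Fin (n + n)) L}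

set_option maxHeartbeats 3200000 in
/-- **RIGIDITY UNDER A GALOIS TRANSPORT: `Ψ ∘ s^𝔻_{T₀, μ} = s^𝔻_{t•T₀, μ} ∘ scaleInl`.**  CM field `L`, `F = L⁺`,
`T₀ = diag` (`hT₀'t` for `T₀′ = t•T₀`), the CM local splitting data `s^𝔻_{T, μ}` (`localSplittingDatumCM` at the Hecke
character `χ = μ`), `σ ∈ Aut(ℂ)` fixing `M_μ` pointwise (`hσ`), and a monoid homomorphism
`Ψ : S̃p_ψ(𝕎^𝔻_v, T₀^𝔻) →* S̃p_ψ(𝕎^𝔻_v, (t•T₀)^𝔻)` over the identity on linear maps (`hΨproj`) reading values at the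
origin through `σ` along a surjection `B` of `𝒮` (`hB`, `hB0`, `hΨB`), such that `Ψ ∘ s^𝔻_{T₀,μ}` lies over `ι^𝔻 ∘ scaleInl`
(`hSproj`).  Then `Ψ ∘ s^𝔻_{T₀,μ} = s^𝔻_{t•T₀,μ} ∘ scaleInl`.  Instantiated with `Ψ = e_{D_s} ∘ galTwist σ`
(`LocalMpGaloisTwist` + `LocalMpAddCharRescaling`, `κ_σ = t s²` from `AdelicAdditiveCharacterGaloisTwist`), this is
«the `σ`-twist of the `μ`-splitting of `⟨a⟩` is the `μ`-splitting of `⟨t a⟩`» on the nose — [Liu2021]'s «Since `Gal(ℂ/M_μ)`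
stabilizes `μ`» step of the ε-rigidity under Galois twist, via Kudla's rigidity of the `P_Δ`-normalised splitting.
[cite: Liu2021, proof of Thm. 4.18 (3), l. 2272] [cite: Kudla1994, Thm 3.1] [cite: GelbartRogawski1991, §3.1 Remark p. 457 L4–13] -/
theorem comp_localSplittingDatumCM_eq_of_galoisTransport (hn : 0 < n) (a : (maximalRealSubfield L)ˣ)
    (t' : Fin n → maximalRealSubfield L) (hT₀'t : T₀' = Matrix.diagonal t')
    (hT₀ : T₀.IsSymm) (hT₀d : IsUnit T₀.det) (hT₀' : T₀'.IsSymm) (hT₀'d : IsUnit T₀'.det)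
    (hDD : gramD (maximalRealSubfield L) n T₀' = (a : maximalRealSubfield L) • gramD (maximalRealSubfield L) n T₀)
    (hJD : JD = (gramD (maximalRealSubfield L) n T₀).map (algebraMap (maximalRealSubfield L) L))
    (hJD' : JD' = (gramD (maximalRealSubfield L) n T₀').map (algebraMap (maximalRealSubfield L) L))
    (ψ : IdeleClassGroup L →ₜ* Circle) (hχ : IsSplittingChar L 1 (toHeckeCharacter L ψ))
    (σ : ℂ ≃+* ℂ) (hσ : ∀ z ∈ Liu2021.fieldOfValues L ψ, σ z = z)
    (Ψ : LocalMp (maximalRealSubfield L) (n + n) (gramD (maximalRealSubfield L) n T₀) v →*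
      LocalMp (maximalRealSubfield L) (n + n) (gramD (maximalRealSubfield L) n T₀') v)
    (hΨproj : ∀ x,
      ((MpPsi.proj _ (Ψ x) : LocalSp (maximalRealSubfield L) (n + n) (gramD (maximalRealSubfield L) n T₀') v) :
          ((Fin (n + n) → v.adicCompletion (maximalRealSubfield L)) × (Fin (n + n) → v.adicCompletion (maximalRealSubfield L))) ≃ₗ[v.adicCompletion (maximalRealSubfield L)]
            ((Fin (n + n) → v.adicCompletion (maximalRealSubfield L)) × (Fin (n + n) → v.adicCompletion (maximalRealSubfield L)))) =
        (MpPsi.proj _ x : LocalSp (maximalRealSubfield L) (n + n) (gramD (maximalRealSubfield L) n T₀) v))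
    (B : SchwartzBruhat (Fin (n + n) → v.adicCompletion (maximalRealSubfield L)) →
      SchwartzBruhat (Fin (n + n) → v.adicCompletion (maximalRealSubfield L)))
    (hB : Function.Surjective B)
    (hB0 : ∀ f, (B f : (Fin (n + n) → v.adicCompletion (maximalRealSubfield L)) → ℂ) 0 =
      σ ((f : (Fin (n + n) → v.adicCompletion (maximalRealSubfield L)) → ℂ) 0))
    (hΨB : ∀ x f,
      ((MpPsi.toRep (localSchrodinger (maximalRealSubfield L) (n + n) (gramD (maximalRealSubfield L) n T₀') v) (Ψ x) (B f) :
          SchwartzBruhat (Fin (n + n) → v.adicCompletion (maximalRealSubfield L))) :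
          (Fin (n + n) → v.adicCompletion (maximalRealSubfield L)) → ℂ) 0 =
        σ (((MpPsi.toRep (localSchrodinger (maximalRealSubfield L) (n + n) (gramD (maximalRealSubfield L) n T₀) v) x f :
          SchwartzBruhat (Fin (n + n) → v.adicCompletion (maximalRealSubfield L))) :
          (Fin (n + n) → v.adicCompletion (maximalRealSubfield L)) → ℂ) 0))
    (hSproj : ∀ k : UnitaryGroup.localPi L (IsCMField.complexConj L) (n + n) JD v,
      MpPsi.proj _ (Ψ ((localSplittingDatumCM L v μ n hT₀ hT₀d hJD (toHeckeCharacter L ψ) hχ).localSplitting k)) =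
        iota (maximalRealSubfield L) L (IsCMField.complexConj L) (n + n) (complexConj_imagUnit L) (imagUnit_ne_zero L)
          (imagUnit_mul_self L) (gramD (maximalRealSubfield L) n T₀') (gramD_isSymm (maximalRealSubfield L) n hT₀') hJD' v
          (scaleInl (maximalRealSubfield L) L (IsCMField.complexConj L) (n + n) (gramD (maximalRealSubfield L) n T₀)
            (gramD (maximalRealSubfield L) n T₀') a hDD hJD hJD' v k)) :
    Ψ.comp (localSplittingDatumCM L v μ n hT₀ hT₀d hJD (toHeckeCharacter L ψ) hχ).localSplitting =
      (localSplittingDatumCM L v μ n hT₀' hT₀'d hJD' (toHeckeCharacter L ψ) hχ).localSplitting.comp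
        (scaleInl (maximalRealSubfield L) L (IsCMField.complexConj L) (n + n) (gramD (maximalRealSubfield L) n T₀)
          (gramD (maximalRealSubfield L) n T₀') a hDD hJD hJD' v) := by
  classical
  -- reduce to the section `S′ := Ψ ∘ s_{T₀} ∘ scaleInv` on `H′ = U((t•T₀)^𝔻 ⊗ 1)(F_v)`
  suffices hS : (Ψ.comp (localSplittingDatumCM L v μ n hT₀ hT₀d hJD (toHeckeCharacter L ψ) hχ).localSplitting).comp
      (scaleInv (maximalRealSubfield L) L (IsCMField.complexConj L) (n + n) (gramD (maximalRealSubfield L) n T₀)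
        (gramD (maximalRealSubfield L) n T₀') a hDD hJD hJD' v) =
      (localSplittingDatumCM L v μ n hT₀' hT₀'d hJD' (toHeckeCharacter L ψ) hχ).localSplitting by
    refine MonoidHom.ext fun k => ?_
    have h := DFunLike.congr_fun hS (scaleInl (maximalRealSubfield L) L (IsCMField.complexConj L) (n + n)
      (gramD (maximalRealSubfield L) n T₀) (gramD (maximalRealSubfield L) n T₀') a hDD hJD hJD' v k)
    rw [MonoidHom.comp_apply, MonoidHom.comp_apply, scaleInv_scaleInl] at h
    rw [MonoidHom.comp_apply, MonoidHom.comp_apply, h]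
  -- the mover `Ψ m₀`
  obtain ⟨m₀, hm₀⟩ := exists_mover_deltaLagrangian (maximalRealSubfield L) v n hT₀d
  have htoLin : ∀ x, toLin (maximalRealSubfield L) v (MpPsi.proj _ (Ψ x)) = toLin (maximalRealSubfield L) v (MpPsi.proj _ x) :=
    fun x => congrArg LinearEquiv.toLinearMap (hΨproj x)
  have hm : (deltaLagrangian (maximalRealSubfield L) v n).map (toLin (maximalRealSubfield L) v (MpPsi.proj _ (Ψ m₀))) =
      lagrangianY (maximalRealSubfield L) (n + n) v := by
    rw [htoLin, hm₀]
  -- every character of `H′(F_v)` trivial on `P_Δ` is trivial (diagonal `T₀′`, all places)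
  have hκ : ∀ θ : UnitaryGroup.localPi L (IsCMField.complexConj L) (n + n) JD' v →* ℂˣ,
      (∀ p, IsSiegelDelta (maximalRealSubfield L) L (IsCMField.complexConj L) (complexConj_imagUnit L) (imagUnit_ne_zero L)
        (imagUnit_mul_self L) v n hT₀' hJD' p → θ p = 1) → θ = 1 := fun θ hθ =>
    eq_one_of_forall_isSiegelDelta_eq_one' (maximalRealSubfield L) L (IsCMField.complexConj L) (complexConj_imagUnit L)
      (imagUnit_ne_zero L) (imagUnit_mul_self L) v n hn t' hT₀'t hT₀' hT₀'d hJD' θ hθ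
  -- rigidity at `T₀′`
  refine eq_of_parabolic_toRep_conj_eq (maximalRealSubfield L) L (IsCMField.complexConj L) (complexConj_imagUnit L)
    (imagUnit_ne_zero L) (imagUnit_mul_self L) v n hT₀' hT₀'d hJD'
    (localSplittingDatumCM L v μ n hT₀' hT₀'d hJD' (toHeckeCharacter L ψ) hχ).localSplitting
    ((Ψ.comp (localSplittingDatumCM L v μ n hT₀ hT₀d hJD (toHeckeCharacter L ψ) hχ).localSplitting).comp
      (scaleInv (maximalRealSubfield L) L (IsCMField.complexConj L) (n + n) (gramD (maximalRealSubfield L) n T₀)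
        (gramD (maximalRealSubfield L) n T₀') a hDD hJD hJD' v))
    (fun p => ?_) hκ
    (fun p => (((chiDet (maximalRealSubfield L) L (IsCMField.complexConj L) v n
        (fun w' : PlacesOver L v => ((toHeckeCharacter L ψ).localComponent w'.1)⁻¹) p)⁻¹ : ℂˣ) : ℂ) *
      ((∏ w' : PlacesOver L v,
        Real.sqrt ‖detDelta (maximalRealSubfield L) L (IsCMField.complexConj L) v n w' p‖ : ℝ) : ℂ))
    (fun p hp => ?_) (Ψ m₀) (fun p hp Φ => ?_) (fun p hp Φ => ?_)
  · -- both sections lie over `ι^𝔻_{T₀′}`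
    rw [LocalSplittingDatum.proj_localSplitting, MonoidHom.comp_apply, MonoidHom.comp_apply, hSproj, scaleInl_scaleInv]
  · -- the scalar does not vanish on `P_Δ`
    exact parabolicScalar_ne_zero (maximalRealSubfield L) L (IsCMField.complexConj L) (complexConj_imagUnit L)
      (imagUnit_ne_zero L) (imagUnit_mul_self L) v n hT₀' hJD' _ hp
  · -- the CM splitting of `T₀′` is `P_Δ`-normalised with that scalar
    exact parabolic_toRep_conj_localSplittingDatumCM L v μ n hT₀' hT₀'d hJD' (toHeckeCharacter L ψ) hχ (Ψ m₀) hm p hp Φ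
  · -- the transported section: write `p = scaleInl q`; conjugation by `Ψ m₀` is `Ψ` of conjugation by `m₀`; values at `0`
    -- pass through `σ`, and `σ` fixes the scalar (`LocalParabolicScalarGaloisFixed`)
    obtain ⟨q, rfl⟩ : ∃ q, scaleInl (maximalRealSubfield L) L (IsCMField.complexConj L) (n + n) (gramD (maximalRealSubfield L) n T₀)
        (gramD (maximalRealSubfield L) n T₀') a hDD hJD hJD' v q = p :=
      ⟨_, scaleInl_scaleInv (maximalRealSubfield L) L (IsCMField.complexConj L) (n + n) (gramD (maximalRealSubfield L) n T₀)
        (gramD (maximalRealSubfield L) n T₀') a hDD hJD hJD' v p⟩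
    have hq' : IsSiegelDelta (maximalRealSubfield L) L (IsCMField.complexConj L) (complexConj_imagUnit L) (imagUnit_ne_zero L)
        (imagUnit_mul_self L) v n hT₀ hJD q :=
      (isSiegelDelta_scaleInl_iff (maximalRealSubfield L) L (IsCMField.complexConj L) a v hT₀ hT₀' hDD hJD hJD'
        (complexConj_imagUnit L) (imagUnit_ne_zero L) (imagUnit_mul_self L) (complexConj_imagUnit L) (imagUnit_ne_zero L)
        (imagUnit_mul_self L) q).1 hp
    have hB' : ∃ f, B f = Φ := hB Φ
    refine hB'.elim fun f hf => ?_
    have hconj : Ψ m₀ * ((Ψ.comp (localSplittingDatumCM L v μ n hT₀ hT₀d hJD (toHeckeCharacter L ψ) hχ).localSplitting).comp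
        (scaleInv (maximalRealSubfield L) L (IsCMField.complexConj L) (n + n) (gramD (maximalRealSubfield L) n T₀)
          (gramD (maximalRealSubfield L) n T₀') a hDD hJD hJD' v))
        (scaleInl (maximalRealSubfield L) L (IsCMField.complexConj L) (n + n) (gramD (maximalRealSubfield L) n T₀)
          (gramD (maximalRealSubfield L) n T₀') a hDD hJD hJD' v q) * (Ψ m₀)⁻¹ =
        Ψ (m₀ * (localSplittingDatumCM L v μ n hT₀ hT₀d hJD (toHeckeCharacter L ψ) hχ).localSplitting q * m₀⁻¹) := by
      rw [MonoidHom.comp_apply, MonoidHom.comp_apply, scaleInv_scaleInl, Ψ.map_mul, Ψ.map_mul, Ψ.map_inv]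
    have h1 := hΨB (m₀ * (localSplittingDatumCM L v μ n hT₀ hT₀d hJD (toHeckeCharacter L ψ) hχ).localSplitting q * m₀⁻¹) f
    rw [hf] at h1
    have h0 := hB0 f
    rw [hf] at h0
    have h2 := parabolic_toRep_conj_localSplittingDatumCM L v μ n hT₀ hT₀d hJD (toHeckeCharacter L ψ) hχ m₀ hm₀ q hq' f
    have h3 := ringEquiv_parabolicScalar_eq (maximalRealSubfield L) L (IsCMField.complexConj L) v n ψ σ hσ q
    rw [hconj, h1, h2, map_mul, h3, ← h0]
    simp only [chiDet_scaleInl, detDelta_scaleInl]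

end CM

end Literature.NumberTheory.GelbartRogawski1991.UnitaryDualPair.LocalSplitting

end
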